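import Summits.QuantumFields.BalabanUV.T4Continuum.Support.SliceSubspaceRegular
import Summits.QuantumFields.BalabanUV.T4Continuum.Support.RegularGaugePerturbation
import Summits.QuantumFields.BalabanUV.T4Continuum.Support.VariationalVectorGaugeSliceB5
import Summits.QuantumFields.BalabanUV.T4Continuum.Support.VariationalVectorGarding
import Summits.QuantumFields.BalabanUV.T4Continuum.Support.VariationalVectorRegularityCovariant

/-!
# T⁴ programme, spine node NE2 (U1a), lane P2 — (GF3) WITH BACKGROUND IN THE REGULAR GAUGE: THE COERCIVITY BINDER OF THE VECTOR END FOR BAŁABAN's PROJECTED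
# GAUGE FUNCTIONAL `projG R (ker Q′_1)` — `n^{−d}(n²·divSq_R W) ≤ C_D·ScV n M R (projG R (ker Q′_1)) W + C_D′·nsqV (Q_{lineT 1 R} W)` for unitary `R` in a regular
# small gauge (`‖R − 1‖ ≤ a`, `‖R(x,μ) − R(x−e_μ,μ)‖ ≤ ℓ`, plaquette `≤ p`; smallness of `na`, `n²ℓ`, `n²p` explicit), `C_D = 48·C_f + 1`, `C_D′ = 8·C_f + 1`,
# `C_f = d(d+1)·Cst(d,1)` the flat constant — by PERTURBATION of pv15's (1.90) (`garding_flat`) through the slice-subspace closeness of file 3 (model level, `E = ℂ`)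

NE2 formalisation swarm `b2b-balaban-t4-ne2-formalise-*`, leaf prover 03 GEN 6 (`prover-b2b-balaban-t4-ne2-formalise-leaf-03-g6-0`); journal INTENT
CLAIMS.log l.18308 «(GF3) WITH BACKGROUND IN THE REGULAR GAUGE».  On top of files 1–4 of this item (`SubspacePairPerturbation`, `RegularLaplacianRelativeBound`,
`SliceSubspaceRegular.{regEps, norm_proj_flat_le}`, `RegularGaugePerturbation.{curlSq_flat_le, divSq_le_flat, nsqv_divV_sub_flat_le, nsqV_QvL_flat_le}`),
leaf-09-g7's `VariationalVectorGaugeSliceB5.garding_flat` ((1.90) at `U = 1`, kernel), leaf-09-g6's `VariationalVectorGarding.{qWV_le_line_landau,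
garding_of_poincare, qWV_le_line_of_divControl}` and `VariationalVectorWeitzenbock.divSq_le_mul_roughV` — BY NAME.

THE ARGUMENT ([folklore]; `α = na`, `ε = regEps d n a ℓ ≤ ½`, physical units `X ↦ n^{−d}n²·X`).  Flat (GF3): `D₁ ≤ C_f(S₁ + N₁)`; perturbations (file 4):
`Cu₁ ≤ 2Cu_R + 4dα²q`, `D_R ≤ 2D₁ + 2dα²q`, `N₁ ≤ 2N_R + 2α²q`; slice closeness (file 3) + divergence perturbation: `G₁ ≤ 12G_R + 48ε²D_R + 3dα²q`; Landau V-P with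
background (leaf-09-g6): `q ≤ C_L(Cu_R + D_R + N_R)`, `C_L = max(80, 16 + 640d(n²p))`.  Hence `D_R(1 − 96C_fε² − κα²C_L) ≤ (24C_f + κα²C_L)S_R + (4C_f + κα²C_L)N_R`,
`κ = C_f(14d + 4) + 2d`, and under `96C_fε² + κα²C_L ≤ ½`: **`D_R ≤ (48C_f + 1)·S_R + (8C_f + 1)·N_R`** (`divControl_projG_regular`).  Corollaries: V-P (`hPc_projG_regular`)
and (Går) (`garding_projG_regular`) for `projG` WITH BACKGROUND by leaf-09-g6's reductions — so, with `VariationalVectorRegularityCovariant.hREG_projG_line_of_divControl`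
(item 1), the vector END's `hREG` ∕ `hPc` ∕ (Går) sockets for Bałaban's functional in the regular gauge display ONLY V-UB.

HONEST FRAMING (T4-DAG p. 1).  Rung (B)+1 only — NOT infinite volume, NOT a mass gap, NOT Clay.  NE2 NOT IN PRINT, NOT proved here.  MODEL LEVEL, `E = ℂ`: `R` DATA in a
regular GLOBAL gauge with FLAT site transports (`T′ = 1`, `K = ker Q′_1`, `Q = QvL (lineT 1 R)`); the covariant taxi-`T′` carriers are NOT covered (memo
`t4/T4-EST-NE2-P2-REG.md` §4: same numerics, different mechanism); the smallness constants are explicit and NOT optimised (`ε ≤ ½`, `96C_fε² + κα²C_L ≤ ½`); c5.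
OURS, [folklore] perturbation theory; nothing printed is a hypothesis; no `def`, no `def … : Prop`, no `sorry`; axioms standard.  (ONE-min)∕(SLICE-min) with background
stay OPEN; V-END ∕ NE2 NOT proved; NE3 OPEN; spine PROVED 0∕9.  HONEST DEPENDENCY (cell, verbatim): continuum YM on T⁴ ⇐ BetaPertH ∧ nine spine estimates (0/9 proved);
BetaPertH ⇐ (D1) ∧ (D4) ∧ CAP+tail; G-an2-4 gates asym, D1 and NE2/3/4.
-/

noncomputable section

namespace Summit.QuantumFields.BalabanUV.T4Continuum.ProjGDivControlRegular

open Finset WithLp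
open scoped InnerProductSpace BigOperators
open Literature.MathematicalPhysics.QuantumFieldTheory.Balaban1983to89.B5Prop11Plancherel (Tor fine unitVec Cst Cst_nonneg)
open Literature.MathematicalPhysics.QuantumFieldTheory.Balaban1983to89.B5Blocks16 (blockOf)
open Summit.QuantumFields.BalabanUV.T4Continuum.VariationalColourFederbush (norm_le_one_of_mem_unitary)
open Summit.QuantumFields.BalabanUV.T4Continuum.VariationalColourBochner (nsqv nsqv_nonneg)
open Summit.QuantumFields.BalabanUV.T4Continuum.VariationalVectorWeitzenbock (divV divSq divSq_nonneg divSq_le_mul_roughV)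
open Summit.QuantumFields.BalabanUV.T4Continuum.VariationalVectorForm (curlSq ScV qWV curlSq_nonneg ScV_nonneg qWV_nonneg)
open Summit.QuantumFields.BalabanUV.T4Continuum.VectorBlockTrialForm (nsqV nsqV_nonneg QvL roughV roughV_nonneg)
open Summit.QuantumFields.BalabanUV.T4Continuum.VariationalVectorFederbush (lineT norm_lineT_le_one)
open Summit.QuantumFields.BalabanUV.T4Continuum.VariationalVectorGaugeSlice (sliceSub projG projG_nonneg norm_toLp_sq)
open Summit.QuantumFields.BalabanUV.T4Continuum.VariationalVectorGaugeSliceFlat (kerAvgFlat)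
open Summit.QuantumFields.BalabanUV.T4Continuum.VariationalVectorGaugeSliceB5 (flatR garding_flat)
open Summit.QuantumFields.BalabanUV.T4Continuum.VariationalVectorGarding (landauG qWV_le_line_landau garding_of_poincare qWV_le_line_of_divControl)
open Summit.QuantumFields.BalabanUV.T4Continuum.SliceSubspaceRegular (regEps regEps_nonneg norm_proj_flat_le norm_toLp_eq_sqrt)
open Summit.QuantumFields.BalabanUV.T4Continuum.RegularGaugePerturbation (curlSq_flat_le divSq_le_flat nsqv_divV_sub_flat_le nsqV_QvL_flat_le)
open Summit.QuantumFields.BalabanUV.T4Continuum.VariationalVectorOneStepPhys (rhoV)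
open Summit.QuantumFields.BalabanUV.T4Continuum.CovariantBlockReversePoincare (revPC)
open Summit.QuantumFields.BalabanUV.T4Continuum.VariationalVectorRegularityCovariant (hREG_projG_line_of_divControl)

variable {d : ℕ} (n : ℕ) [NeZero n] (M : Fin d → ℕ) [hM : ∀ μ, NeZero (M μ)]

/-! ## §1 The flat divergence control and the projected-functional comparison -/

/-- **(GF3) AT `U = 1`** (from leaf-09-g7's `garding_flat` and `divSq ≤ d·roughV`): `n^{−d}(n²·divSq_1 W) ≤ d(d+1)Cst(d,1)·(ScV_1 W + nsqV (Q_1 W))`. [folklore] -/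
theorem divControl_flat (W : Tor (fine n M) → Fin d → ℂ) :
    ((n : ℝ) ^ d)⁻¹ * ((n : ℝ) ^ 2 * divSq (fine n M) (flatR n M) W)
      ≤ (d * ((d + 1 : ℝ) * Cst d 1)) * (ScV n M (flatR n M) (projG (fine n M) (flatR n M) (kerAvgFlat n M)) W
          + nsqV M (QvL n M (fun _ _ _ _ => (1 : ℂ →L[ℂ] ℂ)) W)) := by
  have hU1 : ∀ (x : Tor (fine n M)) (μ : Fin d), flatR n M x μ ∈ unitary (ℂ →L[ℂ] ℂ) := fun _ _ => Submonoid.one_mem _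
  have h1 := divSq_le_mul_roughV n M hU1 W
  have h2 := garding_flat n M one_pos W
  rw [one_mul] at h2
  have hn : (0 : ℝ) ≤ ((n : ℝ) ^ d)⁻¹ * (n : ℝ) ^ 2 := by positivity
  calc ((n : ℝ) ^ d)⁻¹ * ((n : ℝ) ^ 2 * divSq (fine n M) (flatR n M) W) ≤ ((n : ℝ) ^ d)⁻¹ * ((n : ℝ) ^ 2 * (d * roughV n M (flatR n M) W)) := by
        rw [← mul_assoc, ← mul_assoc]; exact mul_le_mul_of_nonneg_left h1 hn
    _ = d * (((n : ℝ) ^ d)⁻¹ * ((n : ℝ) ^ 2 * roughV n M (flatR n M) W)) := by ring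
    _ ≤ _ := by rw [mul_assoc]; exact mul_le_mul_of_nonneg_left h2 (Nat.cast_nonneg d)

/-- **THE FLAT PROJECTED FUNCTIONAL IS CONTROLLED BY THE BACKGROUND ONE** (`ε = regEps ≤ ½`):
`projG 1 (ker Q′_1) W ≤ 12·projG R (ker Q′_1) W + 48ε²·divSq_R W + 3d·a²·nsqV W`. [folklore] -/
theorem projG_flat_le {R : Tor (fine n M) → Fin d → (ℂ →L[ℂ] ℂ)} (hU : ∀ x μ, R x μ ∈ unitary (ℂ →L[ℂ] ℂ)) {a ℓ : ℝ}
    (ha : ∀ x μ, ‖R x μ - 1‖ ≤ a) (hℓ : ∀ x μ, ‖R x μ - R (x - unitVec (fine n M) μ) μ‖ ≤ ℓ) (hε : regEps d n a ℓ ≤ 1 / 2) (W : Tor (fine n M) → Fin d → ℂ) :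
    projG (fine n M) (flatR n M) (kerAvgFlat n M) W
      ≤ 12 * projG (fine n M) R (kerAvgFlat n M) W + 48 * regEps d n a ℓ ^ 2 * divSq (fine n M) R W + 3 * d * a ^ 2 * nsqV (fine n M) W := by
  set ε := regEps d n a ℓ with hεdef
  set S1 := sliceSub (fine n M) (flatR n M) (kerAvgFlat n M)
  set SR := sliceSub (fine n M) R (kerAvgFlat n M)
  set v : PiLp 2 (fun _ : Tor (fine n M) => ℂ) := toLp 2 (divV (fine n M) R W) with hv
  set v1 : PiLp 2 (fun _ : Tor (fine n M) => ℂ) := toLp 2 (divV (fine n M) (flatR n M) W) with hv1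
  have hε0 : 0 ≤ ε := regEps_nonneg (d := d) n a ℓ
  have hεlt : ε < 1 := by linarith
  -- the slice comparison for `v = div_R W`
  have hcmp : (1 - ε) * ‖S1.starProjection v‖ ≤ ‖SR.starProjection v‖ + ε / (1 - ε) * ‖v‖ := norm_proj_flat_le n M hU ha hℓ hεlt v
  have hP1v : ‖S1.starProjection v‖ ≤ 2 * ‖SR.starProjection v‖ + 4 * ε * ‖v‖ := by
    have h1e : 1 / 2 ≤ 1 - ε := by linarith
    have hfrac : ε / (1 - ε) ≤ 2 * ε := by rw [div_le_iff₀ (by linarith)]; nlinarith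
    have t : (1 - ε) * ‖S1.starProjection v‖ ≤ ‖SR.starProjection v‖ + 2 * ε * ‖v‖ :=
      hcmp.trans (add_le_add le_rfl (mul_le_mul_of_nonneg_right hfrac (norm_nonneg _)))
    nlinarith [t, norm_nonneg (S1.starProjection v), norm_nonneg (SR.starProjection v), norm_nonneg v]
  -- `Π_1 v1` against `Π_1 v`: projection of the divergence perturbation
  have hdiff : ‖v1 - v‖ ^ 2 ≤ d * a ^ 2 * nsqV (fine n M) W := by
    have h := nsqv_divV_sub_flat_le (fine n M) ha W
    rw [hv1, hv, ← toLp_sub, norm_toLp_sq]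
    have e : ∑ x, ‖(divV (fine n M) (flatR n M) W - divV (fine n M) R W) x‖ ^ 2 = nsqv (fine n M) (divV (fine n M) R W - divV (fine n M) (flatR n M) W) := by
      unfold nsqv; exact sum_congr rfl fun x _ => by rw [Pi.sub_apply, Pi.sub_apply, norm_sub_rev]
    rw [e]; exact h
  have hP1v1 : ‖S1.starProjection v1‖ ≤ ‖S1.starProjection v‖ + ‖v1 - v‖ := by
    calc ‖S1.starProjection v1‖ = ‖S1.starProjection v + S1.starProjection (v1 - v)‖ := by rw [← map_add, add_sub_cancel]
      _ ≤ ‖S1.starProjection v‖ + ‖S1.starProjection (v1 - v)‖ := norm_add_le _ _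
      _ ≤ _ := add_le_add le_rfl (Submodule.norm_starProjection_apply_le S1 _)
  -- squares
  have hG1 : projG (fine n M) (flatR n M) (kerAvgFlat n M) W = ‖S1.starProjection v1‖ ^ 2 := rfl
  have hGR : projG (fine n M) R (kerAvgFlat n M) W = ‖SR.starProjection v‖ ^ 2 := rfl
  have hDR : divSq (fine n M) R W = ‖v‖ ^ 2 := by rw [hv, norm_toLp_sq]; rfl
  rw [hG1, hGR, hDR]
  have hsum : ‖S1.starProjection v1‖ ≤ 2 * ‖SR.starProjection v‖ + 4 * ε * ‖v‖ + ‖v1 - v‖ := by linarith [hP1v1, hP1v]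
  have h0 : 0 ≤ ‖S1.starProjection v1‖ := norm_nonneg _
  have hsq := pow_le_pow_left₀ h0 hsum 2
  nlinarith [hsq, hdiff, sq_nonneg (2 * ‖SR.starProjection v‖ - 4 * ε * ‖v‖), sq_nonneg (2 * ‖SR.starProjection v‖ - ‖v1 - v‖), sq_nonneg (4 * ε * ‖v‖ - ‖v1 - v‖),
    norm_nonneg (SR.starProjection v), norm_nonneg v, norm_nonneg (v1 - v)]

/-! ## §2 (GF3) with background in the regular gauge -/

/-- **(GF3) WITH BACKGROUND IN THE REGULAR GAUGE** (model level, `E = ℂ`, flat site transports).  Unitary `R` with `‖R − 1‖ ≤ a`, `‖R(x,μ) − R(x−e_μ,μ)‖ ≤ ℓ`,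
plaquette defect `≤ p`; classes `2d(na)² ≤ ½`, `40d(n²p) ≤ 1`, `ε := regEps d n a ℓ ≤ ½` and the one genuine smallness condition
`96·C_f·ε² + κ·(na)²·C_L ≤ ½` (`C_f = d(d+1)Cst(d,1)`, `κ = C_f(14d+4) + 2d`, `C_L = max(80, 16 + 640·d(n²p))`).  THEN for every 1-form `W`:
`n^{−d}(n²·divSq_R W) ≤ (48C_f + 1)·ScV n M R (projG R (ker Q′_1)) W + (8C_f + 1)·nsqV (Q_{lineT 1 R} W)`. [folklore] -/
theorem divControl_projG_regular {R : Tor (fine n M) → Fin d → (ℂ →L[ℂ] ℂ)} (hU : ∀ x μ, R x μ ∈ unitary (ℂ →L[ℂ] ℂ)) {a ℓ p : ℝ} (ha0 : 0 ≤ a)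
    (ha : ∀ x μ, ‖R x μ - 1‖ ≤ a) (hℓ : ∀ x μ, ‖R x μ - R (x - unitVec (fine n M) μ) μ‖ ≤ ℓ) (hp : 0 ≤ p)
    (hP : ∀ x μ ν, ‖R x μ * R (x + unitVec (fine n M) μ) ν - R x ν * R (x + unitVec (fine n M) ν) μ‖ ≤ p)
    (hsmallw : 2 * (d : ℝ) * ((n : ℝ) * a) ^ 2 ≤ 1 / 2) (hsmallp : 40 * (d * ((n : ℝ) ^ 2 * p)) ≤ 1) (hε : regEps d n a ℓ ≤ 1 / 2)
    (hsmall : 96 * (d * ((d + 1 : ℝ) * Cst d 1)) * regEps d n a ℓ ^ 2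
      + ((d * ((d + 1 : ℝ) * Cst d 1)) * (14 * d + 4) + 2 * d) * ((n : ℝ) * a) ^ 2
        * max (20 * (2 * (1 + (1 : ℝ)))) (16 + 20 * (2 * (0 + d * ((n : ℝ) ^ 2 * p) * 16))) ≤ 1 / 2)
    (W : Tor (fine n M) → Fin d → ℂ) :
    ((n : ℝ) ^ d)⁻¹ * ((n : ℝ) ^ 2 * divSq (fine n M) R W)
      ≤ (48 * (d * ((d + 1 : ℝ) * Cst d 1)) + 1) * ScV n M R (projG (fine n M) R (kerAvgFlat n M)) W
        + (8 * (d * ((d + 1 : ℝ) * Cst d 1)) + 1) * nsqV M (QvL n M (lineT n M (fun _ => (1 : ℂ →L[ℂ] ℂ)) R) W) := by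
  have hn : (0 : ℝ) < n := by exact_mod_cast Nat.pos_of_ne_zero (NeZero.ne n)
  have hR1 : ∀ x μ, ‖R x μ‖ ≤ 1 := fun x μ => norm_le_one_of_mem_unitary (hU x μ)
  -- the six external facts, in raw form
  have rF1 := divControl_flat n M W
  have rF2 := curlSq_flat_le (fine n M) (R := R) ha W
  have rF3 := divSq_le_flat (fine n M) (R := R) ha W
  have rF4 := nsqV_QvL_flat_le n M hR1 ha0 ha W
  have rF5 := projG_flat_le n M hU ha hℓ hε W
  have hT' : ∀ x : Tor (fine n M), (fun _ => (1 : ℂ →L[ℂ] ℂ)) x ∈ unitary (ℂ →L[ℂ] ℂ) := fun _ => Submonoid.one_mem _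
  have hw : ∀ (x : Tor (fine n M)) (μ : Fin d), blockOf n M (x + unitVec (fine n M) μ) = blockOf n M x →
      ‖R x μ * star ((fun _ => (1 : ℂ →L[ℂ] ℂ)) (x + unitVec (fine n M) μ)) * (fun _ => (1 : ℂ →L[ℂ] ℂ)) x - 1‖ ≤ a := by
    intro x μ _; simpa using ha x μ
  have rF6 := qWV_le_line_landau n M hT' hU hw hsmallw hp hP hsmallp one_pos W
  have eSR : ScV n M R (projG (fine n M) R (kerAvgFlat n M)) W
      = ((n : ℝ) ^ d)⁻¹ * (n : ℝ) ^ 2 * (curlSq (fine n M) R W / 2) + ((n : ℝ) ^ d)⁻¹ * (n : ℝ) ^ 2 * projG (fine n M) R (kerAvgFlat n M) W := by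
    unfold ScV; ring
  have eS1 : ScV n M (flatR n M) (projG (fine n M) (flatR n M) (kerAvgFlat n M)) W
      = ((n : ℝ) ^ d)⁻¹ * (n : ℝ) ^ 2 * (curlSq (fine n M) (flatR n M) W / 2) + ((n : ℝ) ^ d)⁻¹ * (n : ℝ) ^ 2 * projG (fine n M) (flatR n M) (kerAvgFlat n M) W := by
    unfold ScV; ring
  have eSL : ScV n M R (landauG (fine n M) 1 R) W
      = ((n : ℝ) ^ d)⁻¹ * (n : ℝ) ^ 2 * (curlSq (fine n M) R W / 2) + ((n : ℝ) ^ d)⁻¹ * (n : ℝ) ^ 2 * divSq (fine n M) R W := by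
    unfold ScV landauG; rw [inv_one, one_mul]; ring
  have eq' : qWV n M W = ((n : ℝ) ^ d)⁻¹ * nsqV (fine n M) W := rfl
  rw [eSR]; rw [eS1] at rF1; rw [eSL] at rF6; rw [eq'] at rF4 rF6
  -- names (values cleared: pure real arithmetic from here)
  have hCf0 : 0 ≤ (d * ((d + 1 : ℝ) * Cst d 1)) := by have := Cst_nonneg d (1 : ℝ); positivity
  have hCL0 : (0 : ℝ) ≤ max (20 * (2 * (1 + (1 : ℝ)))) (16 + 20 * (2 * (0 + d * ((n : ℝ) ^ 2 * p) * 16))) := le_max_of_le_left (by norm_num)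
  have hε0 : 0 ≤ regEps d n a ℓ := regEps_nonneg (d := d) n a ℓ
  have hX0 : 0 ≤ ((n : ℝ) ^ d)⁻¹ * (n : ℝ) ^ 2 := by positivity
  have hXd : 0 ≤ ((n : ℝ) ^ d)⁻¹ := by positivity
  have hcu0 := curlSq_nonneg (fine n M) R W
  have hg0 := projG_nonneg (fine n M) R (kerAvgFlat n M) W
  have hdv0 := divSq_nonneg (fine n M) R W
  have hnr0 := nsqV_nonneg M (QvL n M (lineT n M (fun _ => (1 : ℂ →L[ℂ] ℂ)) R) W)
  have hw0 := nsqV_nonneg (fine n M) W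
  set X : ℝ := ((n : ℝ) ^ d)⁻¹ * (n : ℝ) ^ 2 with hX
  set Y : ℝ := ((n : ℝ) ^ d)⁻¹ with hY
  set Cf : ℝ := d * ((d + 1 : ℝ) * Cst d 1) with hCf
  set CL : ℝ := max (20 * (2 * (1 + (1 : ℝ)))) (16 + 20 * (2 * (0 + d * ((n : ℝ) ^ 2 * p) * 16))) with hCL
  set ε : ℝ := regEps d n a ℓ with hεd
  set cuR : ℝ := curlSq (fine n M) R W with hcuR
  set cu1 : ℝ := curlSq (fine n M) (flatR n M) W with hcu1
  set gR : ℝ := projG (fine n M) R (kerAvgFlat n M) W with hgR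
  set g1 : ℝ := projG (fine n M) (flatR n M) (kerAvgFlat n M) W with hg1
  set dR : ℝ := divSq (fine n M) R W with hdR
  set d1 : ℝ := divSq (fine n M) (flatR n M) W with hd1
  set NR : ℝ := nsqV M (QvL n M (lineT n M (fun _ => (1 : ℂ →L[ℂ] ℂ)) R) W) with hNR
  set N1 : ℝ := nsqV M (QvL n M (fun _ _ _ _ => (1 : ℂ →L[ℂ] ℂ)) W) with hN1
  set w : ℝ := nsqV (fine n M) W with hwd
  set dd : ℝ := (d : ℝ) with hdd
  set nn : ℝ := (n : ℝ) with hnn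
  clear_value X Y Cf CL ε cuR cu1 gR g1 dR d1 NR N1 w dd nn
  have hdd0 : 0 ≤ dd := by rw [hdd]; exact Nat.cast_nonneg d
  -- X = Y * nn^2
  have hXY : X = Y * nn ^ 2 := by rw [hX, hY]
  subst hXY
  -- (F1)…(F6) in physical units
  have hF1 : Y * nn ^ 2 * d1 ≤ Cf * (Y * nn ^ 2 * (cu1 / 2) + Y * nn ^ 2 * g1 + N1) := by linarith only [rF1]
  have hF2 : Y * nn ^ 2 * (cu1 / 2) ≤ 2 * (Y * nn ^ 2 * (cuR / 2)) + 4 * dd * ((nn * a) ^ 2 * (Y * w)) := by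
    have h' := mul_le_mul_of_nonneg_left rF2 hX0; linarith only [h']
  have hF3 : Y * nn ^ 2 * dR ≤ 2 * (Y * nn ^ 2 * d1) + 2 * dd * ((nn * a) ^ 2 * (Y * w)) := by
    have h' := mul_le_mul_of_nonneg_left rF3 hX0; linarith only [h']
  have hF4 : N1 ≤ 2 * NR + 2 * ((nn * a) ^ 2 * (Y * w)) := by linarith only [rF4]
  have hF5 : Y * nn ^ 2 * g1 ≤ 12 * (Y * nn ^ 2 * gR) + 48 * ε ^ 2 * (Y * nn ^ 2 * dR) + 3 * dd * ((nn * a) ^ 2 * (Y * w)) := by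
    have h' := mul_le_mul_of_nonneg_left rF5 hX0; linarith only [h']
  have hF6 : Y * w ≤ CL * (Y * nn ^ 2 * (cuR / 2) + Y * nn ^ 2 * dR + NR) := by linarith only [rF6]
  -- abstract the physical quantities
  set CuR := Y * nn ^ 2 * (cuR / 2) with hCuR
  set Cu1 := Y * nn ^ 2 * (cu1 / 2) with hCu1
  set GR := Y * nn ^ 2 * gR with hGR
  set G1 := Y * nn ^ 2 * g1 with hG1
  set DR := Y * nn ^ 2 * dR with hDR
  set D1 := Y * nn ^ 2 * d1 with hD1
  set AQ := (nn * a) ^ 2 * (Y * w) with hAQ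
  set q := Y * w with hq
  clear_value CuR Cu1 GR G1 DR D1 AQ q
  have hCuR0 : 0 ≤ CuR := by rw [hCuR]; positivity
  have hGR0 : 0 ≤ GR := by rw [hGR]; positivity
  have hDR0 : 0 ≤ DR := by rw [hDR]; positivity
  have hq0 : 0 ≤ q := by rw [hq]; positivity
  have hα0 : 0 ≤ (nn * a) ^ 2 := sq_nonneg _
  -- assembly
  have hAQ' : AQ ≤ (nn * a) ^ 2 * (CL * (CuR + DR + NR)) := by rw [hAQ]; exact mul_le_mul_of_nonneg_left hF6 hα0
  have hκ0 : 0 ≤ Cf * (14 * dd + 4) + 2 * dd := by positivity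
  set T : ℝ := (Cf * (14 * dd + 4) + 2 * dd) * (nn * a) ^ 2 * CL with hT
  have hT0 : 0 ≤ T := by rw [hT]; positivity
  have h96 : 0 ≤ 96 * Cf * ε ^ 2 := by positivity
  have hsmall' : 96 * Cf * ε ^ 2 + T ≤ 1 / 2 := hsmall
  have h1 : DR ≤ 2 * (Cf * (Cu1 + G1 + N1)) + 2 * dd * AQ := by linarith only [hF3, hF1]
  have h2 : Cf * (Cu1 + G1 + N1) ≤ Cf * ((2 * CuR + 4 * dd * AQ) + (12 * GR + 48 * ε ^ 2 * DR + 3 * dd * AQ) + (2 * NR + 2 * AQ)) :=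
    mul_le_mul_of_nonneg_left (by linarith only [hF2, hF4, hF5]) hCf0
  have h2' : Cf * ((2 * CuR + 4 * dd * AQ) + (12 * GR + 48 * ε ^ 2 * DR + 3 * dd * AQ) + (2 * NR + 2 * AQ))
      = 2 * (Cf * CuR) + 12 * (Cf * GR) + 48 * (Cf * ε ^ 2 * DR) + 2 * (Cf * NR) + (Cf * (7 * dd + 2)) * AQ := by ring
  have hchain : DR ≤ 4 * (Cf * CuR) + 24 * (Cf * GR) + 96 * (Cf * ε ^ 2 * DR) + 4 * (Cf * NR) + (Cf * (14 * dd + 4) + 2 * dd) * AQ := by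
    rw [h2'] at h2; linarith only [h1, h2]
  have hTbound : (Cf * (14 * dd + 4) + 2 * dd) * AQ ≤ T * (CuR + DR + NR) := by
    calc (Cf * (14 * dd + 4) + 2 * dd) * AQ ≤ (Cf * (14 * dd + 4) + 2 * dd) * ((nn * a) ^ 2 * (CL * (CuR + DR + NR))) := mul_le_mul_of_nonneg_left hAQ' hκ0
      _ = T * (CuR + DR + NR) := by rw [hT]; ring
  have hmain : DR ≤ (24 * Cf + T) * (CuR + GR) + (4 * Cf + T) * NR + (96 * Cf * ε ^ 2 + T) * DR := by
    have p1 := mul_nonneg hCf0 hCuR0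
    have p2 := mul_nonneg hT0 hGR0
    linarith only [hchain, hTbound, p1, p2]
  have htDR : (96 * Cf * ε ^ 2 + T) * DR ≤ (1 / 2) * DR := mul_le_mul_of_nonneg_right hsmall' hDR0
  have hfin : DR ≤ 2 * ((24 * Cf + T) * (CuR + GR)) + 2 * ((4 * Cf + T) * NR) := by linarith only [hmain, htDR]
  have hT12 : T ≤ 1 / 2 := by linarith only [hsmall', h96]
  have hSR0 : 0 ≤ CuR + GR := add_nonneg hCuR0 hGR0
  have eL : Y * (nn ^ 2 * dR) = DR := by rw [hDR, mul_assoc]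
  rw [eL]
  have p3 := mul_le_mul_of_nonneg_right hT12 hSR0
  have p4 := mul_le_mul_of_nonneg_right hT12 hnr0
  linarith only [hfin, p3, p4]

/-! ## §3 Corollaries: V-P and V-REG for Bałaban's functional in the regular gauge display ONLY V-UB -/

/-- **LEAF V-P WITH BACKGROUND IN THE REGULAR GAUGE** (leaf-09-g6's `qWV_le_line_of_divControl` fed with `divControl_projG_regular`):
`qWV n M W ≤ C_P·(ScV n M R (projG R (ker Q′_1)) W + nsqV (Q_{lineT 1 R} W))`, `C_P = max(40(2 + 48C_f), 16 + 40(8C_f + 1 + 16d(n²p)))`. [folklore] -/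
theorem hPc_projG_regular {R : Tor (fine n M) → Fin d → (ℂ →L[ℂ] ℂ)} (hU : ∀ x μ, R x μ ∈ unitary (ℂ →L[ℂ] ℂ)) {a ℓ p : ℝ} (ha0 : 0 ≤ a)
    (ha : ∀ x μ, ‖R x μ - 1‖ ≤ a) (hℓ : ∀ x μ, ‖R x μ - R (x - unitVec (fine n M) μ) μ‖ ≤ ℓ) (hp : 0 ≤ p)
    (hP : ∀ x μ ν, ‖R x μ * R (x + unitVec (fine n M) μ) ν - R x ν * R (x + unitVec (fine n M) ν) μ‖ ≤ p)
    (hsmallw : 2 * (d : ℝ) * ((n : ℝ) * a) ^ 2 ≤ 1 / 2) (hsmallp : 40 * (d * ((n : ℝ) ^ 2 * p)) ≤ 1) (hε : regEps d n a ℓ ≤ 1 / 2)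
    (hsmall : 96 * (d * ((d + 1 : ℝ) * Cst d 1)) * regEps d n a ℓ ^ 2
      + ((d * ((d + 1 : ℝ) * Cst d 1)) * (14 * d + 4) + 2 * d) * ((n : ℝ) * a) ^ 2
        * max (20 * (2 * (1 + (1 : ℝ)))) (16 + 20 * (2 * (0 + d * ((n : ℝ) ^ 2 * p) * 16))) ≤ 1 / 2)
    (W : Tor (fine n M) → Fin d → ℂ) :
    qWV n M W ≤ max (20 * (2 * (1 + (48 * (d * ((d + 1 : ℝ) * Cst d 1)) + 1))))
        (16 + 20 * (2 * ((8 * (d * ((d + 1 : ℝ) * Cst d 1)) + 1) + d * ((n : ℝ) ^ 2 * p) * 16)))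
      * (ScV n M R (projG (fine n M) R (kerAvgFlat n M)) W + nsqV M (QvL n M (lineT n M (fun _ => (1 : ℂ →L[ℂ] ℂ)) R) W)) := by
  have hT' : ∀ x : Tor (fine n M), (fun _ => (1 : ℂ →L[ℂ] ℂ)) x ∈ unitary (ℂ →L[ℂ] ℂ) := fun _ => Submonoid.one_mem _
  have hw : ∀ (x : Tor (fine n M)) (μ : Fin d), blockOf n M (x + unitVec (fine n M) μ) = blockOf n M x →
      ‖R x μ * star ((fun _ => (1 : ℂ →L[ℂ] ℂ)) (x + unitVec (fine n M) μ)) * (fun _ => (1 : ℂ →L[ℂ] ℂ)) x - 1‖ ≤ a := by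
    intro x μ _; simpa using ha x μ
  have hG0 : ∀ W, 0 ≤ projG (fine n M) R (kerAvgFlat n M) W := fun W => projG_nonneg (fine n M) R _ W
  exact qWV_le_line_of_divControl n M hT' hU hw hsmallw hp hP hsmallp hG0
    (fun W => divControl_projG_regular n M hU ha0 ha hℓ hp hP hsmallw hsmallp hε hsmall W) W

/-- **LEAF V-REG FOR BAŁABAN's PROJECTED GAUGE FUNCTIONAL WITH BACKGROUND IN THE REGULAR GAUGE — ONLY V-UB DISPLAYED** (item 1's
`hREG_projG_line_of_divControl` with its coercivity binder (GF3) DISCHARGED by `divControl_projG_regular`): for every datum `φ` and every minimiser `W` of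
`ScV n M R (projG R (ker Q′_1))` on `{Q_{lineT 1 R} · = φ}`, `rhoV n M R W ≤ C_R·(ScV W + nsqV φ)` with `C_R` explicit in `Λ`, `d`, `n²p`, `n·a`, `C_f`. [folklore] -/
theorem hREG_projG_regular {R : Tor (fine n M) → Fin d → (ℂ →L[ℂ] ℂ)} (hU : ∀ x μ, R x μ ∈ unitary (ℂ →L[ℂ] ℂ)) {a ℓ p : ℝ} (ha0 : 0 ≤ a)
    (ha : ∀ x μ, ‖R x μ - 1‖ ≤ a) (hℓ : ∀ x μ, ‖R x μ - R (x - unitVec (fine n M) μ) μ‖ ≤ ℓ) (hp : 0 ≤ p)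
    (hP : ∀ x μ ν, ‖R x μ * R (x + unitVec (fine n M) μ) ν - R x ν * R (x + unitVec (fine n M) ν) μ‖ ≤ p)
    (hsmallw : 2 * (d : ℝ) * ((n : ℝ) * a) ^ 2 ≤ 1 / 2) (hsmallp : 40 * (d * ((n : ℝ) ^ 2 * p)) ≤ 1) (hε : regEps d n a ℓ ≤ 1 / 2)
    (hsmall : 96 * (d * ((d + 1 : ℝ) * Cst d 1)) * regEps d n a ℓ ^ 2
      + ((d * ((d + 1 : ℝ) * Cst d 1)) * (14 * d + 4) + 2 * d) * ((n : ℝ) * a) ^ 2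
        * max (20 * (2 * (1 + (1 : ℝ)))) (16 + 20 * (2 * (0 + d * ((n : ℝ) ^ 2 * p) * 16))) ≤ 1 / 2)
    {Λ : ℝ} (hΛ : 0 ≤ Λ)
    (hUBc : ∀ φ : Tor M → Fin d → ℂ, ∃ W, QvL n M (lineT n M (fun _ => (1 : ℂ →L[ℂ] ℂ)) R) W = φ ∧
      ScV n M R (projG (fine n M) R (kerAvgFlat n M)) W ≤ Λ * nsqV M φ) :
    ∀ (φ : Tor M → Fin d → ℂ) (W : Tor (fine n M) → Fin d → ℂ), QvL n M (lineT n M (fun _ => (1 : ℂ →L[ℂ] ℂ)) R) W = φ →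
      (∀ W₂, QvL n M (lineT n M (fun _ => (1 : ℂ →L[ℂ] ℂ)) R) W₂ = φ → ScV n M R (projG (fine n M) R (kerAvgFlat n M)) W
        ≤ ScV n M R (projG (fine n M) R (kerAvgFlat n M)) W₂) →
      rhoV n M R W ≤ (8 * Λ + 2 * d * ((n : ℝ) ^ 2 * p) * (2 * (1 + (48 * (d * ((d + 1 : ℝ) * Cst d 1)) + 1)) + 2 * ((8 * (d * ((d + 1 : ℝ) * Cst d 1)) + 1) + d * ((n : ℝ) ^ 2 * p) * 16))
          + (8 * revPC d n a ^ 2 + 5 * (d : ℝ) ^ 2 * ((n : ℝ) ^ 2 * p) ^ 2)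
            * max (20 * (2 * (1 + (48 * (d * ((d + 1 : ℝ) * Cst d 1)) + 1)))) (16 + 20 * (2 * ((8 * (d * ((d + 1 : ℝ) * Cst d 1)) + 1) + d * ((n : ℝ) ^ 2 * p) * 16))))
        * (ScV n M R (projG (fine n M) R (kerAvgFlat n M)) W + nsqV M φ) := by
  have hT' : ∀ x : Tor (fine n M), (fun _ => (1 : ℂ →L[ℂ] ℂ)) x ∈ unitary (ℂ →L[ℂ] ℂ) := fun _ => Submonoid.one_mem _
  have hw : ∀ (x : Tor (fine n M)) (μ : Fin d), blockOf n M (x + unitVec (fine n M) μ) = blockOf n M x →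
      ‖R x μ * star ((fun _ => (1 : ℂ →L[ℂ] ℂ)) (x + unitVec (fine n M) μ)) * (fun _ => (1 : ℂ →L[ℂ] ℂ)) x - 1‖ ≤ a := by
    intro x μ _; simpa using ha x μ
  have hCf0 : 0 ≤ (d * ((d + 1 : ℝ) * Cst d 1)) := by have := Cst_nonneg d (1 : ℝ); positivity
  exact hREG_projG_line_of_divControl n M hU hT' ha0 hw hsmallw hp hP hsmallp hΛ (by positivity) (by positivity) hUBc
    (fun W => divControl_projG_regular n M hU ha0 ha hℓ hp hP hsmallw hsmallp hε hsmall W)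

end Summit.QuantumFields.BalabanUV.T4Continuum.ProjGDivControlRegular

end
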